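import Summits.CriticalPhenomena.PercolationContinuityZ3.Theorems.PercNearOneGluingNoHeavyPcintNawFreeMemRecords
import HarnessLib

/-!
# PCINT lane, reduction B2d on the dangerous-set automaton — domination `θ^site(p) ≤ p · total n ∅`

Cell `prim-pcint` (PAPER-2 track (iii)), seat `prim-pcint-1` (gen 6); support file (`--supports stmt-CriticalPhenomena-4575`).
Does NOT build on p205010.  Memo: run/shared/lean/prim/pcint/REDUCTIONS.md §B2d.

ACCOUNTING with variable shares (`pow_forced_le_prod_slots`): for a weight family `qv` with `0 ≤ qv k ≤ 1`, `qv` monotone and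
`qv k ^ k ≥ 1 - p` (`k ≤ 2d`), in every world `(1-p)^{#forced} ≤ ∏_{slots} qv (count of the slot)` — the slots at a forced site
`W` are at most `#incTimes W` many (injective records) and each has count `≥ #incTimes W` (count lemma).  Regrouping by steps
(`prod_slots_eq_prod_fofac`, `fofac_eq`), averaging the corner coins with REAL node factors (`sum_orders_prod_coinR`,
`sum_orders_prod_fofac`) and the run identity give `siteTheta_le_freeMem_total : θ^site(p) ≤ p · (freeMemAut τ kt p qv).total n ∅`.
-/

noncomputable section

namespace Summit.CriticalPhenomena.PercolationContinuityZ3.Theorems.Pcint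

open Finset Literature.Probability.Percolation Literature.Probability.LatticeModels
open Literature.Probability.FitznerVanDerHofstad2017 (wordPos_wordInit)

variable {{d : ℕ}}

/-! ### Averaging corner coins with real node factors -/

section Coins

variable {n : ℕ}

/-- The coin factor of node `s` with a real factor `x`, read through a permutation `σ`: `x` if `σ` puts step `s+1` before step `s`,
else `1` (junk `1` for `s + 2 > n`). [folklore] -/
def nodeCoinFactorR (x : ℝ) (γ : Fin n → Fin d × Bool) (s : Fin n) (σ : Equiv.Perm (Fin d × Bool)) : ℝ :=
  if h : (s : ℕ) + 2 ≤ n then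
    (if dirCode (σ (γ ⟨s + 1, by omega⟩)) < dirCode (σ (γ ⟨s, by omega⟩)) then x else 1)
  else 1

/-- The real coin factor read through `o` is `x` on bad nodes and `1` otherwise (for `s + 2 ≤ n`). [folklore] -/
theorem coinFactorR_eq_ite (x : ℝ) (o : Orders d n) (γ : Fin n → Fin d × Bool) (s : Fin n) (h : (s : ℕ) + 2 ≤ n)
    [Decidable (IsBad o γ s)] :
    nodeCoinFactorR x γ s (o (pnode γ s)) = if IsBad o γ s then x else 1 := by
  obtain ⟨k, hk⟩ := s
  unfold nodeCoinFactorR IsBad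
  dsimp only at h ⊢
  rw [dif_pos h]
  by_cases hlt : dirCode (o (pnode γ ⟨k, hk⟩) (γ ⟨k + 1, by omega⟩)) < dirCode (o (pnode γ ⟨k, hk⟩) (γ ⟨k, hk⟩))
  · rw [if_pos hlt, if_pos ⟨h, hlt⟩]
  · rw [if_neg hlt, if_neg fun hh => hlt hh.2]

/-- **Averaging with real node factors.** For a set `CS` of nodes `s` (`s + 2 ≤ n`; the two steps at `s` distinct whenever the
factor `x s` is not one), `Σ_o Π_{s ∈ CS} (x s if the node is bad for o, else 1) = #Orders · Π_{s ∈ CS} (1 + x s)/2`. [folklore] -/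
theorem sum_orders_prod_coinR (γ : Fin n → Fin d × Bool) (CS : Finset (Fin n)) (x : Fin n → ℝ)
    (hCS : ∀ s ∈ CS, ∃ h : (s : ℕ) + 2 ≤ n, x s ≠ 1 → γ ⟨s, by omega⟩ ≠ γ ⟨s + 1, by omega⟩)
    [∀ o : Orders d n, ∀ s, Decidable (IsBad o γ s)] :
    ∑ o : Orders d n, ∏ s ∈ CS, (if IsBad o γ s then x s else 1) =
      Fintype.card (Orders d n) * ∏ s ∈ CS, (1 + x s) / 2 := by
  classical
  set Φ : PNode d n → Equiv.Perm (Fin d × Bool) → ℝ :=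
    fun u σ => ∏ s ∈ CS.filter (fun s => pnode γ s = u), nodeCoinFactorR (x s) γ s σ with hΦ
  have h1 : ∀ o : Orders d n, ∏ s ∈ CS, (if IsBad o γ s then x s else 1) = ∏ u, Φ u (o u) := by
    intro o
    rw [← prod_fiberwise CS (pnode γ)]
    refine prod_congr rfl fun u _ => prod_congr rfl fun s hs => ?_
    obtain ⟨hsC, hsu⟩ := mem_filter.1 hs
    obtain ⟨h, -⟩ := hCS s hsC
    rw [← hsu, coinFactorR_eq_ite (x s) o γ s h]
  set g : PNode d n → ℝ := fun u => ∏ s ∈ CS.filter (fun s => pnode γ s = u), (1 + x s) / 2 with hg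
  have h2 : ∀ u, ∑ σ, Φ u σ = Fintype.card (Equiv.Perm (Fin d × Bool)) * g u := by
    intro u
    by_cases hu : u ∈ CS.image (pnode γ)
    · obtain ⟨s₀, hs₀, hu0⟩ := mem_image.1 hu
      have hfilter : CS.filter (fun s => pnode γ s = u) = {s₀} := by
        ext s
        rw [mem_filter, mem_singleton]
        constructor
        · rintro ⟨-, h⟩; exact pnode_injective γ (h.trans hu0.symm)
        · rintro rfl; exact ⟨hs₀, hu0⟩
      simp only [hΦ, hg, hfilter, prod_singleton]
      obtain ⟨h, hab⟩ := hCS s₀ hs₀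
      simp only [nodeCoinFactorR, dif_pos h]
      by_cases hc : x s₀ = 1
      · simp only [hc, ite_self, sum_const, card_univ, nsmul_eq_mul, mul_one]; ring
      · exact sum_perm_cornerCoin (x s₀) dirCode dirCode_injective (hab hc)
    · have hfilter : CS.filter (fun s => pnode γ s = u) = ∅ := by
        rw [filter_eq_empty_iff]
        intro s hs he
        exact hu (mem_image.2 ⟨s, hs, he⟩)
      simp only [hΦ, hg, hfilter, prod_empty, sum_const, card_univ, nsmul_eq_mul, mul_one]
  simp_rw [h1]
  rw [← Fintype.prod_sum]
  simp_rw [h2]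
  rw [prod_mul_distrib, prod_const, card_univ, Fintype.card_fun]
  push_cast
  congr 1
  rw [hg, prod_fiberwise CS (pnode γ) (fun s => (1 + x s) / 2)]

/-- Reindexing a product over the steps `t < n` whose factors are `1` for `t + 1 < kt` by the nodes `s = t + 1 - kt`,
`s + kt ≤ n` (`kt ≥ 1`). [folklore] -/
theorem prod_range_eq_prod_nodes_shift {kt : ℕ} (hkt : 1 ≤ kt) (G : ℕ → ℝ) (h0 : ∀ t, t + 1 < kt → G t = 1) :
    ∏ t ∈ range n, G t = ∏ s ∈ (univ : Finset (Fin n)).filter (fun s : Fin n => s.1 + kt ≤ n), G (s.1 + kt - 1) := by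
  rw [← prod_filter_of_ne (p := fun t => kt ≤ t + 1) (fun t _ hG => by by_contra h; exact hG (h0 t (by omega)))]
  refine Finset.prod_bij (fun t ht => ⟨t + 1 - kt, by have := mem_range.1 (mem_filter.1 ht).1; omega⟩)
    (fun t ht => ?_) (fun t₁ ht₁ t₂ ht₂ h => ?_) (fun s hs => ?_) (fun t ht => ?_)
  · have h1 := mem_range.1 (mem_filter.1 ht).1
    have h2 := (mem_filter.1 ht).2
    exact mem_filter.2 ⟨mem_univ _, by simp only; omega⟩
  · have h1 := (mem_filter.1 ht₁).2
    have h2 := (mem_filter.1 ht₂).2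
    have := congrArg Fin.val h
    simp only at this
    omega
  · have := (mem_filter.1 hs).2
    exact ⟨s.1 + kt - 1, mem_filter.2 ⟨mem_range.2 (by omega), by omega⟩, Fin.ext (by simp only; omega)⟩
  · have h2 := (mem_filter.1 ht).2
    simp only [show t + 1 - kt + kt - 1 = t by omega]

end Coins

/-! ### Accounting, regrouping by steps, averaging, and the domination -/

section Assembly

open Classical

variable (a₀ : Fin d × Bool) {τ kt n : ℕ} {γ : Fin n → Fin d × Bool}

/-- The count of a slot (its site's `fcnt` at its step; the letter read through `wordAt`). [folklore] -/
def fslotCnt (τ : ℕ) (γ : Fin n → Fin d × Bool) (x : ℕ × Bool × Site d) : ℕ :=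
  fcnt τ (danger τ (pre a₀ γ x.1)) (wordAt a₀ γ x.1) x.2.2

/-- The count of a slot dominates the number of incidences of its site. [folklore] -/
theorem card_incTimes_le_fslotCnt (hτ : 2 ≤ τ) (hs : IsSAW γ) (hch : chordEdges γ = ∅) {o : Orders d n}
    {x : ℕ × Bool × Site d} (hx : x ∈ fslots a₀ τ kt γ o) :
    (incTimes γ (frec kt γ x).1).card ≤ fslotCnt a₀ τ γ x := by
  rcases x with ⟨t, β, w⟩
  obtain ⟨ht, -, -⟩ := (mem_fslots a₀).1 hx
  simp only [frec, fslotCnt, wordAt_of_lt a₀ γ ht, fabs]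
  exact card_incTimes_le_fcnt a₀ hτ hs hch ht w

set_option maxHeartbeats 800000 in
/-- **Accounting (REDUCTIONS §B2d)**: `r^{#forced} ≤ ∏_{slots} qv(count)` in every world, for `r ≤ qv k ^ k` (`k ≤ 2d`), `qv` monotone
with values in `[0,1]`. [folklore] -/
theorem pow_forced_le_prod_slots (hτ : 2 ≤ τ) (hkt : 2 * kt ≤ τ) (hkt2 : 2 ≤ kt) (hs : IsSAW γ) (hch : chordEdges γ = ∅)
    (o : Orders d n) {r : ℝ} {qv : ℕ → ℝ} (hr0 : 0 ≤ r) (hq0 : ∀ k, 0 ≤ qv k) (hq1 : ∀ k, qv k ≤ 1)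
    (hmono : ∀ k k', k ≤ k' → qv k ≤ qv k') (hrq : ∀ k, k ≤ 2 * d → r ≤ qv k ^ k) :
    r ^ (forcedSites o γ).card ≤ ∏ x ∈ fslots a₀ τ kt γ o, qv (fslotCnt a₀ τ γ x) := by
  set S := fslots a₀ τ kt γ o
  have hmaps : ∀ x ∈ S, (frec kt γ x).1 ∈ forcedSites o γ := by
    intro x hx
    have h := frec_mem_cincSet a₀ hτ hkt hkt2 hs hch hx
    rw [cincSet, mem_biUnion] at h
    obtain ⟨w, hw, hwi⟩ := h
    obtain ⟨i, -, hi⟩ := mem_image.1 hwi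
    rw [← hi]; exact hw
  rw [← prod_fiberwise_of_maps_to hmaps, show r ^ (forcedSites o γ).card = ∏ _W ∈ forcedSites o γ, r from
    (prod_const r).symm]
  refine prod_le_prod (fun _ _ => hr0) fun W _ => ?_
  set T := S.filter fun x => (frec kt γ x).1 = W
  set R := (incTimes γ W).card
  have hR : R ≤ 2 * d := card_incTimes_le hs W
  have hT : T.card ≤ R := card_fiber_le_incTimes a₀ hτ hkt hkt2 hs hch o W
  calc r ≤ qv R ^ R := hrq R hR
    _ ≤ qv R ^ T.card := pow_le_pow_of_le_one (hq0 R) (hq1 R) hT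
    _ = ∏ _x ∈ T, qv R := by rw [prod_const]
    _ ≤ ∏ x ∈ T, qv (fslotCnt a₀ τ γ x) := prod_le_prod (fun _ _ => hq0 R) fun x hx => by
        obtain ⟨hxS, hxW⟩ := mem_filter.1 hx
        refine hmono _ _ ?_
        have := card_incTimes_le_fslotCnt a₀ hτ hs hch hxS
        rw [hxW] at this
        exact this

variable (τ kt γ)

/-- The factor of step `t` in the world of `o`: `∏_{w included} qv(fcnt w)^{fnpay w}`. [folklore] -/
def fofac (o : Orders d n) (qv : ℕ → ℝ) (t : ℕ) : ℝ :=
  if ht : t < n then ∏ w ∈ fincl a₀ τ kt γ o t ht,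
    qv (fcnt τ (danger τ (pre a₀ γ t)) (γ ⟨t, ht⟩) w) ^ fnpay τ kt (danger τ (pre a₀ γ t)) (γ ⟨t, ht⟩) w else 1

/-- The symmetric factor of step `t`: `fwt`. [folklore] -/
def fsfac (qv : ℕ → ℝ) (t : ℕ) : ℝ := if ht : t < n then fwt τ kt qv (danger τ (pre a₀ γ t)) (γ ⟨t, ht⟩) else 1

variable {τ kt γ}

/-- The payments of the included sites of a step as a product over the two kinds. [folklore] -/
theorem prod_fincl_eq (o : Orders d n) (qv : ℕ → ℝ) (t : ℕ) (ht : t < n) :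
    ∏ w ∈ fincl a₀ τ kt γ o t ht, qv (fcnt τ (danger τ (pre a₀ γ t)) (γ ⟨t, ht⟩) w) ^
        fnpay τ kt (danger τ (pre a₀ γ t)) (γ ⟨t, ht⟩) w =
      (∏ w ∈ (fincl a₀ τ kt γ o t ht).filter (fun w => fprepay kt (danger τ (pre a₀ γ t)) (γ ⟨t, ht⟩) w = true),
          qv (fcnt τ (danger τ (pre a₀ γ t)) (γ ⟨t, ht⟩) w)) *
        ∏ w ∈ (fincl a₀ τ kt γ o t ht).filter (fun w => fself τ kt (danger τ (pre a₀ γ t)) (γ ⟨t, ht⟩) w = true),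
          qv (fcnt τ (danger τ (pre a₀ γ t)) (γ ⟨t, ht⟩) w) := by
  rw [prod_filter, prod_filter, ← prod_mul_distrib]
  refine prod_congr rfl fun w _ => ?_
  unfold fnpay
  split_ifs <;> simp [pow_succ]

set_option maxHeartbeats 800000 in
/-- **Regrouping the slots by steps**: `∏_{slots} qv(count) = ∏_{t<n} fofac t`. [folklore] -/
theorem prod_slots_eq_prod_fofac (o : Orders d n) (qv : ℕ → ℝ) :
    ∏ x ∈ fslots a₀ τ kt γ o, qv (fslotCnt a₀ τ γ x) = ∏ t ∈ range n, fofac a₀ τ kt γ o qv t := by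
  rw [fslots, prod_biUnion]
  · rw [← prod_attach (range n)]
    refine prod_congr rfl fun t _ => ?_
    have ht : t.1 < n := mem_range.1 t.2
    rw [prod_union, prod_image (fun w _ w' _ h => by simpa using h), prod_image (fun w _ w' _ h => by simpa using h),
      fofac, dif_pos ht, prod_fincl_eq]
    · simp only [fslotCnt, wordAt_of_lt a₀ γ ht]
    · rw [Finset.disjoint_left]
      rintro x hx hx'
      obtain ⟨w, -, rfl⟩ := mem_image.1 hx
      obtain ⟨w', -, h⟩ := mem_image.1 hx'
      simpa using congrArg (fun y => y.2.1) h
  · intro t _ t' _ htt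
    simp only [Function.onFun]
    rw [Finset.disjoint_left]
    rintro x hx hx'
    have h1 : x.1 = t.1 := by
      rcases mem_union.1 hx with h | h <;> { obtain ⟨w, -, rfl⟩ := mem_image.1 h; rfl }
    have h2 : x.1 = t'.1 := by
      rcases mem_union.1 hx' with h | h <;> { obtain ⟨w, -, rfl⟩ := mem_image.1 h; rfl }
    exact htt (Subtype.ext (h1.symm.trans h2))

/-- No known vertex of age `kt` before step `kt - 1`: then there are no inspected sites. [folklore] -/
theorem fsites_eq_empty {t : ℕ} (ht : t < n) (hk : t + 1 < kt) :
    fsites kt (danger τ (pre a₀ γ t)) (γ ⟨t, ht⟩) = ∅ := by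
  rw [eq_empty_iff_forall_notMem]
  intro w hw
  exact absurd (fsites_spec a₀ ht hw).1 (by omega)

/-- `fC = 1` when the step has no conditional payment. [folklore] -/
theorem fC_eq_one_of_not_fhasC {S : MState d} {a : Fin d × Bool} (qv : ℕ → ℝ) (h : fhasC τ kt S a = false) :
    fC τ kt qv S a = 1 := by
  unfold fC
  refine prod_eq_one fun w hw => ?_
  split_ifs with hc
  · have : fnpay τ kt S a w = 0 := by
      by_contra hne
      have : fhasC τ kt S a = true := (fhasC_iff τ kt).2 ⟨w, hw, hc, hne⟩
      rw [h] at this; exact Bool.noConfusion this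
    rw [this, pow_zero]
  · rfl

/-- **The world factor splits**: `fofac o t = fU_t · (fC_t if the corner at node `t + 1 - kt` is bad for `o`, else 1)`. [folklore] -/
theorem fofac_eq (o : Orders d n) (qv : ℕ → ℝ) (t : ℕ) (ht : t < n) :
    fofac a₀ τ kt γ o qv t = fU τ kt qv (danger τ (pre a₀ γ t)) (γ ⟨t, ht⟩) *
      (if IsBad o γ (t + 1 - kt) then fC τ kt qv (danger τ (pre a₀ γ t)) (γ ⟨t, ht⟩) else 1) := by
  rw [fofac, dif_pos ht, fincl]
  have hU : fU τ kt qv (danger τ (pre a₀ γ t)) (γ ⟨t, ht⟩) =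
      ∏ w ∈ (fsites kt (danger τ (pre a₀ γ t)) (γ ⟨t, ht⟩)).filter
        (fun w => funcond (danger τ (pre a₀ γ t)) (γ ⟨t, ht⟩) w = true),
      qv (fcnt τ (danger τ (pre a₀ γ t)) (γ ⟨t, ht⟩) w) ^ fnpay τ kt (danger τ (pre a₀ γ t)) (γ ⟨t, ht⟩) w := by
    rw [fU, prod_filter]
  have hC : fC τ kt qv (danger τ (pre a₀ γ t)) (γ ⟨t, ht⟩) =
      ∏ w ∈ (fsites kt (danger τ (pre a₀ γ t)) (γ ⟨t, ht⟩)).filter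
        (fun w => fcond kt (danger τ (pre a₀ γ t)) (γ ⟨t, ht⟩) w = true),
      qv (fcnt τ (danger τ (pre a₀ γ t)) (γ ⟨t, ht⟩) w) ^ fnpay τ kt (danger τ (pre a₀ γ t)) (γ ⟨t, ht⟩) w := by
    rw [fC, prod_filter]
  by_cases hbad : IsBad o γ (t + 1 - kt)
  · rw [if_pos hbad, hU, hC, ← prod_union (disjoint_filter.2 fun w _ hu hc => by
      rw [((fcond_iff kt).1 hc).1] at hu; exact Bool.noConfusion hu)]
    refine prod_congr ?_ fun _ _ => rfl
    rw [← filter_or]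
    exact filter_congr fun w _ => by simp only [hbad, and_true]
  · rw [if_neg hbad, mul_one, hU]
    refine prod_congr ?_ fun _ _ => rfl
    exact filter_congr fun w _ => by simp only [hbad, and_false, or_false]

/-- A step with a conditional payment has distinct letters at the node `t + 1 - kt` (so its corner coin is fair). [folklore] -/
theorem letters_ne_of_fC_ne_one (hτ : 2 ≤ τ) (hkt : 2 * kt ≤ τ) (hkt2 : 2 ≤ kt) (qv : ℕ → ℝ) {t : ℕ} (ht : t < n)
    (hC : fC τ kt qv (danger τ (pre a₀ γ t)) (γ ⟨t, ht⟩) ≠ 1) :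
    ∃ h2 : t + 1 - kt + 2 ≤ n, γ ⟨t + 1 - kt, by omega⟩ ≠ γ ⟨t + 1 - kt + 1, by omega⟩ := by
  have hh : fhasC τ kt (danger τ (pre a₀ γ t)) (γ ⟨t, ht⟩) = true := by
    by_contra h
    rw [Bool.not_eq_true] at h
    exact hC (fC_eq_one_of_not_fhasC qv h)
  obtain ⟨w, hw, hcond, -⟩ := (fhasC_iff τ kt).1 hh
  exact (fcorner_eq_cornerSite a₀ hτ hkt hkt2 ht hw ((fcond_iff kt).1 hcond).2).2

set_option maxHeartbeats 800000 in
/-- **Averaging over the orders**: `Σ_o ∏_t fofac = #Orders · ∏_t fsfac`. [folklore] -/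
theorem sum_orders_prod_fofac (hτ : 2 ≤ τ) (hkt : 2 * kt ≤ τ) (hkt2 : 2 ≤ kt) (qv : ℕ → ℝ) :
    ∑ o : Orders d n, ∏ t ∈ range n, fofac a₀ τ kt γ o qv t =
      Fintype.card (Orders d n) * ∏ t ∈ range n, fsfac a₀ τ kt γ qv t := by
  set UAt : ℕ → ℝ := fun t => if ht : t < n then fU τ kt qv (danger τ (pre a₀ γ t)) (γ ⟨t, ht⟩) else 1 with hUAt
  set CAt : ℕ → ℝ := fun t => if ht : t < n then fC τ kt qv (danger τ (pre a₀ γ t)) (γ ⟨t, ht⟩) else 1 with hCAt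
  set CS : Finset (Fin n) := univ.filter fun s : Fin n => s.1 + kt ≤ n with hCS
  have hC1 : ∀ t, t + 1 < kt → CAt t = 1 := by
    intro t hk
    simp only [hCAt]
    split_ifs with ht
    · rw [fC, fsites_eq_empty a₀ ht hk, prod_empty]
    · rfl
  -- world-o product = (∏ fU) · (coins)
  have hofac : ∀ o : Orders d n, ∏ t ∈ range n, fofac a₀ τ kt γ o qv t =
      (∏ t ∈ range n, UAt t) * ∏ s ∈ CS, (if IsBad o γ s then CAt (s.1 + kt - 1) else 1) := by
    intro o
    have e1 : ∏ t ∈ range n, fofac a₀ τ kt γ o qv t =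
        ∏ t ∈ range n, (UAt t * (if IsBad o γ (t + 1 - kt) then CAt t else 1)) := by
      refine prod_congr rfl fun t ht => ?_
      have ht' := mem_range.1 ht
      simp only [hUAt, hCAt, dif_pos ht', fofac_eq a₀ o qv t ht']
    rw [e1, prod_mul_distrib, prod_range_eq_prod_nodes_shift (by omega : 1 ≤ kt)
      (fun t => if IsBad o γ (t + 1 - kt) then CAt t else (1 : ℝ)) (fun t hk => by simp only [hC1 t hk, ite_self])]
    refine congrArg₂ (· * ·) rfl (prod_congr rfl fun s hs => ?_)
    have := (mem_filter.1 hs).2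
    simp only [show s.1 + kt - 1 + 1 - kt = s.1 by omega]
  -- symmetric product = (∏ fU) · (averaged coins)
  have hsfac : ∏ t ∈ range n, fsfac a₀ τ kt γ qv t = (∏ t ∈ range n, UAt t) * ∏ s ∈ CS, (1 + CAt (s.1 + kt - 1)) / 2 := by
    have e1 : ∏ t ∈ range n, fsfac a₀ τ kt γ qv t = ∏ t ∈ range n, (UAt t * ((1 + CAt t) / 2)) := by
      refine prod_congr rfl fun t ht => ?_
      have ht' := mem_range.1 ht
      simp only [fsfac, hUAt, hCAt, dif_pos ht']
      unfold fwt
      refine congrArg₂ (· * ·) rfl ?_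
      by_cases hh : fhasC τ kt (danger τ (pre a₀ γ t)) (γ ⟨t, ht'⟩) = true
      · rw [if_pos hh]
      · rw [Bool.not_eq_true] at hh
        rw [if_neg (by rw [hh]; exact Bool.false_ne_true), fC_eq_one_of_not_fhasC qv hh]; norm_num
    rw [e1, prod_mul_distrib, prod_range_eq_prod_nodes_shift (by omega : 1 ≤ kt) (fun t => (1 + CAt t) / 2)
      (fun t hk => by rw [hC1 t hk]; norm_num)]
  have hcoins := sum_orders_prod_coinR γ CS (fun s => CAt (s.1 + kt - 1)) (fun s hsC => by
    have h2 := (mem_filter.1 hsC).2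
    refine ⟨by omega, fun hne => ?_⟩
    have hlt : s.1 + kt - 1 < n := by omega
    have hne' : fC τ kt qv (danger τ (pre a₀ γ (s.1 + kt - 1))) (γ ⟨s.1 + kt - 1, hlt⟩) ≠ 1 := by
      simpa [hCAt, dif_pos hlt] using hne
    obtain ⟨_, hne2⟩ := letters_ne_of_fC_ne_one a₀ hτ hkt hkt2 qv hlt hne'
    have e1 : (⟨s.1 + kt - 1 + 1 - kt, (by omega : s.1 + kt - 1 + 1 - kt < n)⟩ : Fin n) = ⟨s.1, by omega⟩ :=
      Fin.ext (by simp only; omega)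
    have e2 : (⟨s.1 + kt - 1 + 1 - kt + 1, (by omega : s.1 + kt - 1 + 1 - kt + 1 < n)⟩ : Fin n) = ⟨s.1 + 1, by omega⟩ :=
      Fin.ext (by simp only; omega)
    rw [e1, e2] at hne2
    simpa using hne2)
  simp_rw [hofac]
  rw [← mul_sum, hcoins, hsfac]
  ring

set_option maxHeartbeats 800000 in
include a₀ in
/-- **Domination of site percolation by the B2d automaton** (REDUCTIONS §B2d on dangerous-set states): `θ^site(p) ≤ p · total n ∅`
for every `n`, when `0 ≤ qv k ≤ 1`, `qv` is monotone, `qv k ^ k ≥ 1 - p` for `k ≤ 2d`, `τ ≥ 2 kt`, `kt ≥ 2`. [folklore] -/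
theorem siteTheta_le_freeMem_total (hτ : 2 ≤ τ) (hkt : 2 * kt ≤ τ) (hkt2 : 2 ≤ kt) (p : unitInterval) {qv : ℕ → ℝ}
    (hq0 : ∀ k, 0 ≤ qv k) (hq1 : ∀ k, qv k ≤ 1) (hmono : ∀ k k', k ≤ k' → qv k ≤ qv k')
    (hpq : ∀ k, k ≤ 2 * d → 1 - (p : ℝ) ≤ qv k ^ k) (n : ℕ) :
    siteTheta (zdGraph d) 0 p ≤ (p : ℝ) * (freeMemAut (d := d) τ kt p qv p.2.1 hq0).total n ∅ := by
  have hp0 : (0 : ℝ) ≤ p := p.2.1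
  have hp1' : 0 ≤ 1 - (p : ℝ) := sub_nonneg.2 p.2.2
  set M := freeMemAut (d := d) τ kt p qv p.2.1 hq0 with hM
  set NW := (sawWords d n).filter fun w => chordEdges w = ∅ with hNW
  -- per order
  have ho : ∀ o : Orders d n, siteTheta (zdGraph d) 0 p ≤
      ∑ γ ∈ NW, (p : ℝ) ^ (n + 1) * ∏ t ∈ range n, fofac a₀ τ kt γ o qv t := by
    intro o
    refine (siteTheta_le_sum_nawRandEvent p o).trans (sum_le_sum fun γ hγ => ?_)
    obtain ⟨hsaw, hch⟩ := mem_filter.1 hγ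
    refine mul_le_mul_of_nonneg_left ?_ (pow_nonneg hp0 _)
    rw [← prod_slots_eq_prod_fofac]
    exact pow_forced_le_prod_slots a₀ hτ hkt hkt2 (mem_sawWords.1 hsaw) hch o hp1' hq0 hq1 hmono hpq
  have hO : (0 : ℝ) < Fintype.card (Orders d n) := Nat.cast_pos.2 Fintype.card_pos
  have hsum := sum_le_sum fun (o : Orders d n) (_ : o ∈ univ) => ho o
  rw [sum_const, card_univ, nsmul_eq_mul, sum_comm] at hsum
  have key : ∑ γ ∈ NW, ∑ o : Orders d n, (p : ℝ) ^ (n + 1) * ∏ t ∈ range n, fofac a₀ τ kt γ o qv t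
      = Fintype.card (Orders d n) * ∑ γ ∈ NW, (p : ℝ) ^ (n + 1) * ∏ t ∈ range n, fsfac a₀ τ kt γ qv t := by
    rw [mul_sum]
    refine sum_congr rfl fun γ _ => ?_
    rw [← mul_sum, sum_orders_prod_fofac a₀ hτ hkt hkt2 qv]
    ring
  rw [key] at hsum
  have h1 : siteTheta (zdGraph d) 0 p ≤ ∑ γ ∈ NW, (p : ℝ) ^ (n + 1) * ∏ t ∈ range n, fsfac a₀ τ kt γ qv t :=
    le_of_mul_le_mul_left hsum hO
  refine h1.trans ?_
  -- the symmetric product is the run of the automaton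
  have hrun : ∀ γ ∈ NW, (p : ℝ) ^ (n + 1) * ∏ t ∈ range n, fsfac a₀ τ kt γ qv t = (p : ℝ) * M.run n ∅ γ := by
    intro γ hγ
    obtain ⟨hsaw, hch⟩ := mem_filter.1 hγ
    have hs := mem_sawWords.1 hsaw
    have h := M.run_eq_prod_of_states n (fun t => danger τ (pre a₀ γ t)) γ (fun t ht => by
      rw [hM]; exact nstep_danger_pre a₀ hτ hs hch ht)
    have h0 : danger τ (pre a₀ γ 0) = ∅ := danger_zero τ _
    rw [h0] at h
    have hwt : ∀ (t : ℕ) (ht : t < n), M.wt (danger τ (pre a₀ γ t)) (γ ⟨t, ht⟩) =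
        (p : ℝ) * fwt τ kt qv (danger τ (pre a₀ γ t)) (γ ⟨t, ht⟩) := fun t ht => by rw [hM]; rfl
    rw [h, pow_succ, mul_comm _ (p : ℝ), mul_assoc]
    congr 1
    rw [show (p : ℝ) ^ n = ∏ _t ∈ range n, (p : ℝ) by rw [prod_const, card_range], ← prod_mul_distrib]
    refine prod_congr rfl fun t ht => ?_
    have ht' := mem_range.1 ht
    rw [dif_pos ht', fsfac, dif_pos ht', hwt t ht']
  calc ∑ γ ∈ NW, (p : ℝ) ^ (n + 1) * ∏ t ∈ range n, fsfac a₀ τ kt γ qv t = ∑ γ ∈ NW, (p : ℝ) * M.run n ∅ γ :=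
        sum_congr rfl hrun
    _ = (p : ℝ) * ∑ γ ∈ NW, M.run n ∅ γ := by rw [mul_sum]
    _ ≤ (p : ℝ) * M.total n ∅ := mul_le_mul_of_nonneg_left (M.sum_run_le_total n ∅ NW) hp0

end Assembly

end Summit.CriticalPhenomena.PercolationContinuityZ3.Theorems.Pcint
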